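import Literature.AlgebraicGeometry.Resolution.BlowupRegularPairCharts
import Mathlib.AlgebraicGeometry.IdealSheaf.Functorial
import Mathlib.AlgebraicGeometry.Morphisms.Separated
import HarnessLib

/-!
# Exceptional hosts over a sub-centre of a regular-pair blow-up: charts and the section

Topic `Literature/AlgebraicGeometry/Resolution`; theorem-only. Let `β : X' → M` be a blowing up
along an ideal sheaf `𝓘` which, on suitable affine opens `W`, is generated by a regular pair
`(u, v)` (`Resolution/BlowupRegularPairCharts`), and let `i₀ : B ↪ M` be a closed immersion into
the centre, `𝓘 ≤ ker i₀`. The **exceptional host** over `B` is the fibre product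
`E = X' ×_M B` with its closed immersion `j = pr₁ : E ↪ X'` and projection `π = pr₂ : E → B`.
This is the configuration of Shioda–Katsura, *On Fermat varieties*, Tôhoku Math. J. 31 (1979),
Thm. 1.7 / (1.6): `M = Xʳ⁺¹ₘ × X¹ₘ`, centre `Xʳₘ × X⁰ₘ`, `B = Bⱼ = Xʳₘ × {pⱼ}` one of its `m`
components, `E = Eⱼ` the exceptional divisor over it, a `ℙ¹`-bundle over `Bⱼ`.

* `exists_ringEquiv_exceptional_piece` — over the chart `X'[W, u]` the host is the affine line
  over `B ∩ W`: `Γ(E, j⁻¹X'[W, u]) ≅ Γ(B, i₀⁻¹W)[X]`, `π^*s ↦ C s`, `j^*T ↦ X` (`T = β^*v/β^*u`);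
* `exists_section_exceptional` — if `B ⊆ M` factors as `B → S → M` through an `L : S → M` along
  which `𝓘` becomes an effective Cartier divisor and `v` dies, the lift of `L` to `X'` gives a
  section `σ : B → E` of `π`, a closed immersion, missing the `v`-charts and containing every point
  of a `u`-chart off `D(T)` (the section "at infinity" of the `ℙ¹`-bundle).

## References

* T. Shioda, T. Katsura, On Fermat varieties, Tôhoku Math. J. 31 (1979) 97–115, §1 (1.6),
  Thm. 1.7, §2 Lemma 2.1. [ShiodaKatsura1979]
* W. Fulton, *Intersection Theory* (1998), proof of Lemma 2.4 (p. 37) and B.6.9. [Fulton1998]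
* The Stacks Project, Tag 0804 (affine blow-up charts). [StacksProject]
-/

noncomputable section

open CategoryTheory CategoryTheory.Limits AlgebraicGeometry TopologicalSpace Opposite Polynomial

universe u

namespace Literature.AlgebraicGeometry.Resolution

variable {M X' B : Scheme.{u}} {β : X' ⟶ M} {𝓘 : M.IdealSheafData} (i₀ : B ⟶ M)

/-! ## The exceptional host over a chart is an affine line -/

/-- `j⁻¹ X'[W, u] ⊆ π⁻¹ i₀⁻¹ W` for the host `E = X' ×_M B` (`j ≫ β = π ≫ i₀`). [folklore] -/
theorem preimage_fst_blowupChart_le (W : M.affineOpens) (u : Γ(M, W)) :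
    pullback.fst β i₀ ⁻¹ᵁ blowupChart β 𝓘 W u ≤ pullback.snd β i₀ ⁻¹ᵁ (i₀ ⁻¹ᵁ (W : M.Opens)) := by
  intro z hz
  have h := blowupChart_le_preimage β 𝓘 W u hz
  change β (pullback.fst β i₀ z) ∈ (W : M.Opens) at h
  change i₀ (pullback.snd β i₀ z) ∈ (W : M.Opens)
  rwa [← Scheme.Hom.comp_apply, ← pullback.condition, Scheme.Hom.comp_apply]

/-- `𝓘(W) ≤ (ker i₀)(W)` when `𝓘 ≤ ker i₀`. [folklore] -/
theorem ideal_le_ker_ideal (hle : 𝓘 ≤ i₀.ker) (W : M.affineOpens) :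
    𝓘.ideal W ≤ i₀.ker.ideal W :=
  hle W

/-- **The exceptional host over a regular-pair chart is the affine line over the sub-centre**
(Fulton, proof of Lemma 2.4: "`π⁻¹(D) ∩ U' = C' × 𝔸¹`"; Shioda–Katsura Thm. 1.7 (ii): `Eⱼ` is
a `ℙ¹`-bundle over `Bⱼ`). For a blowing up `β : X' → M` along `𝓘`, an affine open `W` with
`𝓘(W) = (u, v)` a regular pair, and a closed immersion `i₀ : B ↪ M` with `𝓘 ≤ ker i₀`: with
`T = β^*v/β^*u ∈ Γ(X', X'[W, u])`, there is a ring isomorphism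
`Γ(E, j⁻¹X'[W, u]) ≅ Γ(B, i₀⁻¹W)[X]` (`E = X' ×_M B`, `j = pr₁`, `π = pr₂`) sending `π^*s` to the
constant `s` and `j^*T` to `X` (`Resolution/BlowupRegularPairCharts`:
`Γ(X', X'[W, u])/(ker i₀)(W) ≅ (Γ(W)/(ker i₀)(W))[X]`, and `Γ(W)/(ker i₀)(W) = Γ(B, i₀⁻¹W)`).
[cite: Fulton1998, proof of Lemma 2.4 (p. 37)] [cite: ShiodaKatsura1979, §1 Thm. 1.7 (ii)] -/
theorem exists_ringEquiv_exceptional_piece (hβ : IsBlowup β 𝓘) [IsClosedImmersion i₀]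
    (hle : 𝓘 ≤ i₀.ker) (W : M.affineOpens) {u v : Γ(M, W)} (hI : 𝓘.ideal W = Ideal.span {u, v})
    (hu : u ∈ nonZeroDivisors Γ(M, W)) (huv : ∀ r : Γ(M, W), u ∣ r * v → u ∣ r) :
    ∃ (T : Γ(X', blowupChart β 𝓘 W u))
      (ε : Γ(pullback β i₀, pullback.fst β i₀ ⁻¹ᵁ blowupChart β 𝓘 W u) ≃+*
        (Γ(B, i₀ ⁻¹ᵁ (W : M.Opens)))[X]),
      β.appLE W _ (blowupChart_le_preimage β 𝓘 W u) v =
        β.appLE W _ (blowupChart_le_preimage β 𝓘 W u) u * T ∧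
      (∀ s, ε ((pullback.snd β i₀).appLE (i₀ ⁻¹ᵁ (W : M.Opens))
        (pullback.fst β i₀ ⁻¹ᵁ blowupChart β 𝓘 W u) (preimage_fst_blowupChart_le i₀ W u) s) =
          C s) ∧
      ε ((pullback.fst β i₀).app (blowupChart β 𝓘 W u) T) = Polynomial.X := by
  have huI : u ∈ 𝓘.ideal W := hI ▸ Ideal.subset_span (by simp)
  have hCu : IsAffineOpen (blowupChart β 𝓘 W u) := hβ.isAffineOpen_blowupChart huI
  obtain ⟨e, he⟩ := hβ.exists_ringEquiv_blowupChart_pair W hI hu huv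
  set T := e.symm (Ideal.Quotient.mk _ Polynomial.X) with hTdef
  have hT := appLE_eq_mul_of_ringEquiv_blowupChart_pair W (blowupChart_le_preimage β 𝓘 W u) e he
  -- `K = (ker i₀)(W) ⊇ 𝓘(W) = (u, v)`
  set K : Ideal Γ(M, W) := i₀.ker.ideal W with hKdef
  have hK : Ideal.span {u, v} ≤ K := hI ▸ ideal_le_ker_ideal i₀ hle W
  obtain ⟨ε₀, hε₀C, hε₀X⟩ := exists_ringEquiv_quotient_of_ringEquiv_pair W
    (blowupChart_le_preimage β 𝓘 W u) e he K hK
  -- `Γ(E, j⁻¹ X'[W,u]) = Γ(X', X'[W,u]) / K·Γ` (`j` a closed immersion with `ker j = (ker i₀)·𝒪_{X'}`)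
  set j := pullback.fst β i₀ with hjdef
  have hjsurj : Function.Surjective (j.app (blowupChart β 𝓘 W u)) :=
    j.app_surjective _ hCu
  have hjker : RingHom.ker (j.app (blowupChart β 𝓘 W u)).hom =
      K.map (β.appLE W _ (blowupChart_le_preimage β 𝓘 W u)).hom := by
    rw [← Scheme.Hom.ker_apply j ⟨_, hCu⟩, hjdef, Scheme.IdealSheafData.ker_fst_of_isClosedImmersion,
      ideal_comap_of_le β i₀.ker W ⟨_, hCu⟩ (blowupChart_le_preimage β 𝓘 W u)]
  let ε₁ : Γ(pullback β i₀, j ⁻¹ᵁ blowupChart β 𝓘 W u) ≃+*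
      Γ(X', blowupChart β 𝓘 W u) ⧸ K.map (β.appLE W _ (blowupChart_le_preimage β 𝓘 W u)).hom :=
    ((RingHom.quotientKerEquivOfSurjective hjsurj).symm).trans (Ideal.quotEquivOfEq hjker)
  have hε₁ : ∀ x, ε₁ (j.app (blowupChart β 𝓘 W u) x) = Ideal.Quotient.mk _ x := fun x ↦ by
    change Ideal.quotEquivOfEq hjker ((RingHom.quotientKerEquivOfSurjective hjsurj).symm _) = _
    have : (RingHom.quotientKerEquivOfSurjective hjsurj).symm (j.app (blowupChart β 𝓘 W u) x) =
        Ideal.Quotient.mk _ x := by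
      apply (RingHom.quotientKerEquivOfSurjective hjsurj).injective
      rw [RingEquiv.apply_symm_apply, RingHom.quotientKerEquivOfSurjective_apply_mk]
    rw [this, Ideal.quotEquivOfEq_mk]
  -- `Γ(M, W)/K = Γ(B, i₀⁻¹ W)`
  have hisurj : Function.Surjective (i₀.app W) := i₀.app_surjective _ W.2
  have hiker : RingHom.ker (i₀.app W).hom = K := (Scheme.Hom.ker_apply i₀ W).symm
  set ε₂ : (Γ(M, W) ⧸ K) ≃+* Γ(B, i₀ ⁻¹ᵁ (W : M.Opens)) :=
    (Ideal.quotEquivOfEq hiker.symm).trans (RingHom.quotientKerEquivOfSurjective hisurj) with hε₂def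
  have hε₂ : ∀ a, ε₂ (Ideal.Quotient.mk K a) = i₀.app W a := fun a ↦ by
    rw [hε₂def, RingEquiv.trans_apply, Ideal.quotEquivOfEq_mk]
    exact RingHom.quotientKerEquivOfSurjective_apply_mk hisurj a
  refine ⟨T, ε₁.trans (ε₀.trans (Polynomial.mapEquiv ε₂)), hT, fun s ↦ ?_, ?_⟩
  · obtain ⟨a, rfl⟩ := hisurj s
    have happ : (pullback.snd β i₀).appLE (i₀ ⁻¹ᵁ (W : M.Opens)) (j ⁻¹ᵁ blowupChart β 𝓘 W u)
        (preimage_fst_blowupChart_le i₀ W u) (i₀.app W a) =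
        j.app (blowupChart β 𝓘 W u) (β.appLE W _ (blowupChart_le_preimage β 𝓘 W u) a) := by
      rw [Scheme.Hom.app_eq_appLE i₀, ← CommRingCat.comp_apply, Scheme.Hom.appLE_comp_appLE,
        Scheme.Hom.app_eq_appLE j, ← CommRingCat.comp_apply, Scheme.Hom.appLE_comp_appLE]
      simp_rw [hjdef, pullback.condition]
    rw [happ, RingEquiv.trans_apply, RingEquiv.trans_apply, hε₁, hε₀C, Polynomial.mapEquiv_apply,
      Polynomial.map_C, RingEquiv.coe_toRingHom, hε₂]
  · rw [RingEquiv.trans_apply, RingEquiv.trans_apply, hε₁, hTdef, hε₀X, Polynomial.mapEquiv_apply,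
      Polynomial.map_X]

/-! ## The section of the exceptional host -/

section Section

variable {S : Scheme.{u}} (L : S ⟶ M) (q₀ : B ⟶ S)

/-- **The section of the exceptional host.** If `i₀ : B ↪ M` factors as `B →q₀ S →L M` with
`𝓘 · 𝒪_S` an effective Cartier divisor, the lift `L̃ : S → X'` of `L` through the blowing up
(universal property) restricted to `B` is a section `σ = (q₀ ≫ L̃, 𝟙) : B → E = X' ×_M B` of
`π = pr₂`, a closed immersion as soon as `β` is separated. For Shioda–Katsura Thm. 1.7:
`S = Xʳ⁺¹ₘ × {pⱼ}` (strict transform `≅ S`, the centre being a Cartier divisor on it),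
`B = Bⱼ = Xʳₘ × {pⱼ}`, `σ(Bⱼ) = Eⱼ ∩ (strict transform of S)`.
[cite: ShiodaKatsura1979, §1 Thm. 1.7 and (1.6)] [cite: Fulton1998, B.6.9–B.6.10] -/
theorem exists_section_exceptional (hβ : IsBlowup β 𝓘) [IsSeparated β]
    (hcart : IsEffectiveCartier (𝓘.comap L)) (hq : q₀ ≫ L = i₀) :
    ∃ σ : B ⟶ pullback β i₀, σ ≫ pullback.snd β i₀ = 𝟙 B ∧
      σ ≫ pullback.fst β i₀ = q₀ ≫ hβ.lift L hcart ∧ IsClosedImmersion σ := by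
  have hcomm : (q₀ ≫ hβ.lift L hcart) ≫ β = 𝟙 B ≫ i₀ := by
    rw [Category.assoc, hβ.lift_comp, hq, Category.id_comp]
  refine ⟨pullback.lift _ _ hcomm, pullback.lift_snd _ _ _, pullback.lift_fst _ _ _, ?_⟩
  haveI : IsClosedImmersion (pullback.lift _ _ hcomm ≫ pullback.snd β i₀) := by
    rw [pullback.lift_snd]
    infer_instance
  exact IsClosedImmersion.of_comp (pullback.lift _ _ hcomm) (pullback.snd β i₀)

variable {L q₀}

/-- **The section misses the `v`-charts**: if `L^*v = 0` on `L⁻¹W` for a generator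
`v ∈ 𝓘(W)`, no point `σ(y)` lies over the chart `X'[W, v]`
(`IsBlowup.notMem_blowupChart_of_app_eq_zero` for the lift `L̃`, `L̃ ≫ β = L`).
[cite: ShiodaKatsura1979, §1 Thm. 1.7] -/
theorem section_notMem_preimage_blowupChart (hβ : IsBlowup β 𝓘)
    (hcart : IsEffectiveCartier (𝓘.comap L)) {σ : B ⟶ pullback β i₀}
    (hσ : σ ≫ pullback.fst β i₀ = q₀ ≫ hβ.lift L hcart) (W : M.affineOpens) {v : Γ(M, W)}
    (hvI : v ∈ 𝓘.ideal W) (hv0 : L.app W v = 0) (y : B) :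
    σ y ∉ pullback.fst β i₀ ⁻¹ᵁ blowupChart β 𝓘 W v := by
  have hcart' : IsEffectiveCartier (𝓘.comap (hβ.lift L hcart ≫ β)) := by rwa [hβ.lift_comp]
  have hv0' : (hβ.lift L hcart ≫ β).app W v = 0 := by
    have h := hβ.lift_comp L hcart
    rw [Scheme.Hom.congr_app h W, CommRingCat.comp_apply, hv0, map_zero]
  have h := hβ.notMem_blowupChart_of_app_eq_zero W hvI (hβ.lift L hcart) hcart' hv0' (q₀ y)
  intro hy
  apply h
  change (pullback.fst β i₀) (σ y) ∈ blowupChart β 𝓘 W v at hy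
  rwa [← Scheme.Hom.comp_apply, hσ, Scheme.Hom.comp_apply] at hy

/-- **Off `D(T)`, the `u`-chart piece of the host is the section**: with `𝓘(W) = (u, v)` a
regular pair, `T = β^*v/β^*u` on `X'[W, u]`, and `L^*v = 0`, every point `z` of `E` with
`j z ∈ X'[W, u] ∖ D(T)` equals `σ(π z)` (`β` is injective on `X'[W, u] ∖ D(T)`,
`IsBlowup.eq_of_notMem_basicOpen_pair`, and `j (σ (π z))` is such a point with the same image
`i₀ (π z)`). Hence `E = σ(B) ∪ ⋃ j⁻¹X'[W, v]`. [cite: ShiodaKatsura1979, §1 Thm. 1.7 (ii)]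
[cite: Fulton1998, proof of Lemma 2.4 (p. 37)] -/
theorem eq_section_of_notMem_basicOpen (hβ : IsBlowup β 𝓘) [IsClosedImmersion i₀]
    (hcart : IsEffectiveCartier (𝓘.comap L)) (hq : q₀ ≫ L = i₀) {σ : B ⟶ pullback β i₀}
    (hσ : σ ≫ pullback.fst β i₀ = q₀ ≫ hβ.lift L hcart)
    (W : M.affineOpens) {u v : Γ(M, W)} (hI : 𝓘.ideal W = Ideal.span {u, v})
    (hu : u ∈ nonZeroDivisors Γ(M, W)) (huv : ∀ r : Γ(M, W), u ∣ r * v → u ∣ r)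
    (hv0 : L.app W v = 0) {T : Γ(X', blowupChart β 𝓘 W u)}
    (hT : β.appLE W _ (blowupChart_le_preimage β 𝓘 W u) v =
      β.appLE W _ (blowupChart_le_preimage β 𝓘 W u) u * T)
    {z : ↑(pullback β i₀)} (hz : pullback.fst β i₀ z ∈ blowupChart β 𝓘 W u)
    (hzT : pullback.fst β i₀ z ∉ X'.basicOpen T) : z = σ (pullback.snd β i₀ z) := by
  have huI : u ∈ 𝓘.ideal W := hI ▸ Ideal.subset_span (by simp)
  have hvI : v ∈ 𝓘.ideal W := hI ▸ Ideal.subset_span (by simp)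
  set z' := σ (pullback.snd β i₀ z) with hz'
  -- `j z'` and `j z` have the same image in `M`
  have hβeq : β (pullback.fst β i₀ z) = β (pullback.fst β i₀ z') := by
    have h1 : β (pullback.fst β i₀ z) = i₀ (pullback.snd β i₀ z) := by
      rw [← Scheme.Hom.comp_apply, pullback.condition, Scheme.Hom.comp_apply]
    have h2 : β (pullback.fst β i₀ z') = i₀ (pullback.snd β i₀ z) := by
      rw [hz', ← Scheme.Hom.comp_apply σ, hσ, ← Scheme.Hom.comp_apply, Category.assoc,
        hβ.lift_comp, hq]
    rw [h1, h2]
  -- `j z'` lies over `W`, not in `X'[W, v]`, hence in `X'[W, u]` and not in `D(T)`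
  have hW' : pullback.fst β i₀ z' ∈ β ⁻¹ᵁ (W : M.Opens) := by
    change β (pullback.fst β i₀ z') ∈ (W : M.Opens)
    rw [← hβeq]
    exact blowupChart_le_preimage β 𝓘 W u hz
  have hnotv : pullback.fst β i₀ z' ∉ blowupChart β 𝓘 W v :=
    section_notMem_preimage_blowupChart i₀ hβ hcart hσ W hvI hv0 _
  have hz'u : pullback.fst β i₀ z' ∈ blowupChart β 𝓘 W u := by
    have hcov := hβ.blowupChart_sup_blowupChart_pair W hI
    rw [← hcov] at hW'
    rcases hW' with h | h
    · exact h
    · exact absurd h hnotv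
  have hz'T : pullback.fst β i₀ z' ∉ X'.basicOpen T := fun h ↦
    hnotv (hβ.basicOpen_le_blowupChart_pair W huI hT h)
  have hjeq := hβ.eq_of_notMem_basicOpen_pair W hI hu huv hT hz hz'u hzT hz'T hβeq
  exact (pullback.fst β i₀).isClosedEmbedding.injective hjeq

/-! ## The complement of the section: polynomial charts -/

/-- **Off the section, the host over `i₀⁻¹W` is the `v`-chart piece**: for `z ∈ E ∖ σ(B)` with
`i₀ (π z) ∈ W`, `j z ∈ X'[W, v]`; conversely `j⁻¹X'[W, v]` misses `σ(B)` and lies over `i₀⁻¹W`.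
[cite: ShiodaKatsura1979, §1 Thm. 1.7 (ii)] -/
theorem mem_preimage_blowupChart_iff_notMem_range_section (hβ : IsBlowup β 𝓘)
    [IsClosedImmersion i₀] (hcart : IsEffectiveCartier (𝓘.comap L)) (hq : q₀ ≫ L = i₀)
    {σ : B ⟶ pullback β i₀} (hσ : σ ≫ pullback.fst β i₀ = q₀ ≫ hβ.lift L hcart)
    (W : M.affineOpens) {u v : Γ(M, W)} (hI : 𝓘.ideal W = Ideal.span {u, v})
    (hu : u ∈ nonZeroDivisors Γ(M, W)) (huv : ∀ r : Γ(M, W), u ∣ r * v → u ∣ r)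
    (hv0 : L.app W v = 0) (z : ↑(pullback β i₀)) :
    pullback.fst β i₀ z ∈ blowupChart β 𝓘 W v ↔
      pullback.snd β i₀ z ∈ i₀ ⁻¹ᵁ (W : M.Opens) ∧ z ∉ Set.range σ := by
  have huI : u ∈ 𝓘.ideal W := hI ▸ Ideal.subset_span (by simp)
  have hvI : v ∈ 𝓘.ideal W := hI ▸ Ideal.subset_span (by simp)
  constructor
  · intro hz
    refine ⟨preimage_fst_blowupChart_le i₀ W v hz, ?_⟩
    rintro ⟨y, rfl⟩
    exact section_notMem_preimage_blowupChart i₀ hβ hcart hσ W hvI hv0 y hz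
  · rintro ⟨hzW, hzσ⟩
    have hW' : pullback.fst β i₀ z ∈ β ⁻¹ᵁ (W : M.Opens) := by
      change β (pullback.fst β i₀ z) ∈ (W : M.Opens)
      rw [← Scheme.Hom.comp_apply, pullback.condition, Scheme.Hom.comp_apply]
      exact hzW
    rw [← hβ.blowupChart_sup_blowupChart_pair W hI] at hW'
    rcases hW' with h | h
    · -- in the `u`-chart: off `D(T)` the point would be on the section
      obtain ⟨e, he⟩ := hβ.exists_ringEquiv_blowupChart_pair W hI hu huv
      have hT := appLE_eq_mul_of_ringEquiv_blowupChart_pair W (blowupChart_le_preimage β 𝓘 W u)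
        e he
      by_contra hzv
      have hzT : pullback.fst β i₀ z ∉ X'.basicOpen (e.symm (Ideal.Quotient.mk _ Polynomial.X)) :=
        fun h' ↦ hzv (hβ.basicOpen_le_blowupChart_pair W huI hT h')
      exact hzσ ⟨_, (eq_section_of_notMem_basicOpen i₀ hβ hcart hq hσ W hI hu huv hv0 hT h hzT).symm⟩
    · exact h

/-- The section has closed range. [folklore] -/
theorem isClosed_range_section {σ : B ⟶ pullback β i₀} [IsClosedImmersion σ] :
    IsClosed (Set.range σ) :=
  σ.isClosedEmbedding.isClosed_range

/-- **Polynomial charts of `E ∖ σ(B) → B`.** With `Eᵒ = E ∖ σ(B)` (an open subscheme) and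
`ρ = π|_{Eᵒ} : Eᵒ → B`: over `V = i₀⁻¹W` for a regular-pair chart `W` on which `L^*v = 0`,
`ρ⁻¹V = j⁻¹X'[W, v] ∖ σ(B) = j⁻¹X'[W, v]` is affine with
`Γ(Eᵒ, ρ⁻¹V) ≅ Γ(E, j⁻¹X'[W, v]) ≅ Γ(B, V)[X]`, `ρ^*s ↦ C s` (`exists_ringEquiv_exceptional_piece`
for the pair `(v, u)`): `Eᵒ → B` is Zariski-locally the affine line (Shioda–Katsura Lemma 2.1:
`Eⱼ ∖ σ(Bⱼ)` is the line bundle of the `ℙ¹`-bundle `Eⱼ → Bⱼ`).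
[cite: ShiodaKatsura1979, §1 Thm. 1.7 (ii) and §2 Lemma 2.1] -/
theorem exists_polynomial_chart_compl_section (hβ : IsBlowup β 𝓘) [IsClosedImmersion i₀]
    (hle : 𝓘 ≤ i₀.ker) (hcart : IsEffectiveCartier (𝓘.comap L)) (hq : q₀ ≫ L = i₀)
    {σ : B ⟶ pullback β i₀} [IsClosedImmersion σ]
    (hσ : σ ≫ pullback.fst β i₀ = q₀ ≫ hβ.lift L hcart)
    (W : M.affineOpens) {u v : Γ(M, W)} (hI : 𝓘.ideal W = Ideal.span {u, v})
    (hu : u ∈ nonZeroDivisors Γ(M, W)) (huv : ∀ r : Γ(M, W), u ∣ r * v → u ∣ r)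
    (hv : v ∈ nonZeroDivisors Γ(M, W)) (hvu : ∀ r : Γ(M, W), v ∣ r * u → v ∣ r)
    (hv0 : L.app W v = 0) :
    let O : (pullback β i₀).Opens :=
      (⟨Set.range σ, isClosed_range_section i₀⟩ : Closeds ↑(pullback β i₀)).compl
    ∃ (_ : IsAffineOpen ((O.ι ≫ pullback.snd β i₀) ⁻¹ᵁ (i₀ ⁻¹ᵁ (W : M.Opens))))
      (e : Γ(O, (O.ι ≫ pullback.snd β i₀) ⁻¹ᵁ (i₀ ⁻¹ᵁ (W : M.Opens))) ≃+*
        (Γ(B, i₀ ⁻¹ᵁ (W : M.Opens)))[X]),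
      ∀ s, e ((O.ι ≫ pullback.snd β i₀).appLE (i₀ ⁻¹ᵁ (W : M.Opens)) _ le_rfl s) = C s := by
  intro O
  have hvI : v ∈ 𝓘.ideal W := hI ▸ Ideal.subset_span (by simp)
  have hI' : 𝓘.ideal W = Ideal.span {v, u} := by rw [hI, Set.pair_comm]
  have hCv : IsAffineOpen (blowupChart β 𝓘 W v) := hβ.isAffineOpen_blowupChart hvI
  -- the chart piece `P = j⁻¹ X'[W, v]`, affine, inside `O`, equal to `ρ⁻¹ V` there
  set P : (pullback β i₀).Opens := pullback.fst β i₀ ⁻¹ᵁ blowupChart β 𝓘 W v with hP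
  have hPaff : IsAffineOpen P := hCv.preimage (pullback.fst β i₀)
  have hPO : P ≤ O := fun z hz ↦
    ((mem_preimage_blowupChart_iff_notMem_range_section i₀ hβ hcart hq hσ W hI hu huv hv0 z).mp
      hz).2
  have hpre : (O.ι ≫ pullback.snd β i₀) ⁻¹ᵁ (i₀ ⁻¹ᵁ (W : M.Opens)) = O.ι ⁻¹ᵁ P := by
    ext z
    change pullback.snd β i₀ (O.ι z) ∈ i₀ ⁻¹ᵁ (W : M.Opens) ↔
      pullback.fst β i₀ (O.ι z) ∈ blowupChart β 𝓘 W v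
    rw [mem_preimage_blowupChart_iff_notMem_range_section i₀ hβ hcart hq hσ W hI hu huv hv0]
    exact ⟨fun h ↦ ⟨h, z.2⟩, fun h ↦ h.1⟩
  have himg : O.ι ''ᵁ (O.ι ⁻¹ᵁ P) = P := by
    rw [Scheme.Hom.image_preimage_eq_opensRange_inf, Scheme.Opens.opensRange_ι]
    exact inf_eq_right.mpr hPO
  have haff : IsAffineOpen ((O.ι ≫ pullback.snd β i₀) ⁻¹ᵁ (i₀ ⁻¹ᵁ (W : M.Opens))) := by
    rw [hpre]
    exact hPaff.preimage_of_isOpenImmersion O.ι (by rw [Scheme.Opens.opensRange_ι]; exact hPO)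
  obtain ⟨T, ε, -, hεC, -⟩ := exists_ringEquiv_exceptional_piece i₀ hβ hle W hI' hv hvu
  -- `Γ(O, ρ⁻¹V) = Γ(O, ι⁻¹P) ≅ Γ(E, ι(ι⁻¹P)) = Γ(E, P)`
  let ι₁ : Γ(O, (O.ι ≫ pullback.snd β i₀) ⁻¹ᵁ (i₀ ⁻¹ᵁ (W : M.Opens))) ≅ Γ(O, O.ι ⁻¹ᵁ P) :=
    (O : Scheme.{u}).presheaf.mapIso (eqToIso hpre).op.symm
  let ι₂ : Γ(O, O.ι ⁻¹ᵁ P) ≅ Γ(pullback β i₀, O.ι ''ᵁ (O.ι ⁻¹ᵁ P)) := (O.ι.appIso _).symm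
  let ι₃ : Γ(pullback β i₀, O.ι ''ᵁ (O.ι ⁻¹ᵁ P)) ≅ Γ(pullback β i₀, P) :=
    (pullback β i₀).presheaf.mapIso (eqToIso himg).op.symm
  refine ⟨haff, (ι₁ ≪≫ ι₂ ≪≫ ι₃).commRingCatIsoToRingEquiv.trans ε, fun s ↦ ?_⟩
  rw [RingEquiv.trans_apply]
  have h1 : (O.ι ≫ pullback.snd β i₀).appLE (i₀ ⁻¹ᵁ (W : M.Opens)) _ le_rfl ≫ ι₁.hom =
      (O.ι ≫ pullback.snd β i₀).appLE (i₀ ⁻¹ᵁ (W : M.Opens)) (O.ι ⁻¹ᵁ P) (by rw [← hpre]) := by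
    change (O.ι ≫ pullback.snd β i₀).appLE _ _ le_rfl ≫ (O : Scheme.{u}).presheaf.map _ = _
    exact Scheme.Hom.appLE_map _ _ _
  have h2 : O.ι.appLE (pullback.snd β i₀ ⁻¹ᵁ (i₀ ⁻¹ᵁ (W : M.Opens))) (O.ι ⁻¹ᵁ P)
      (by rw [← hpre]; exact le_rfl) ≫ ι₂.hom ≫ ι₃.hom =
      (pullback β i₀).presheaf.map (homOfLE (preimage_fst_blowupChart_le i₀ W v)).op := by
    change (O.ι.appLE _ _ _ ≫ (O.ι.appIso _).inv) ≫ (pullback β i₀).presheaf.map _ = _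
    rw [Scheme.Hom.appLE_appIso_inv, ← Functor.map_comp]
    rfl
  have hmor : (O.ι ≫ pullback.snd β i₀).appLE (i₀ ⁻¹ᵁ (W : M.Opens)) _ le_rfl ≫
      ι₁.hom ≫ ι₂.hom ≫ ι₃.hom =
      (pullback.snd β i₀).appLE (i₀ ⁻¹ᵁ (W : M.Opens)) P (preimage_fst_blowupChart_le i₀ W v) := by
    rw [reassoc_of% h1, ← Scheme.Hom.appLE_comp_appLE _ _ _ (pullback.snd β i₀ ⁻¹ᵁ
      (i₀ ⁻¹ᵁ (W : M.Opens))) _ le_rfl (by rw [← hpre]; exact le_rfl), Category.assoc, h2,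
      Scheme.Hom.appLE_map]
  have key : (ι₁ ≪≫ ι₂ ≪≫ ι₃).commRingCatIsoToRingEquiv
      ((O.ι ≫ pullback.snd β i₀).appLE (i₀ ⁻¹ᵁ (W : M.Opens)) _ le_rfl s) =
      (pullback.snd β i₀).appLE (i₀ ⁻¹ᵁ (W : M.Opens)) P (preimage_fst_blowupChart_le i₀ W v) s := by
    rw [← hmor]
    rfl
  rw [key, hεC]

end Section

end Literature.AlgebraicGeometry.Resolution

end
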